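import Summits.BirchSwinnertonDyer.BirchSwinnertonDyer.Theorems.ErratumRoadFiveKolyvaginKernelHLFive
import Summits.BirchSwinnertonDyer.Rank1Residual.X11b.LocalTorsionTamagawa
import HarnessLib

/-!
# Route `ErratumRoadFive` (rung K2a), crux `RamNoErratumDataAtFive` (item stmt-BirchSwinnertonDyer-19624,
# REST‴): REST‴ SHRINKS TO ITS TAMAGAWA PART REST⁗ = REST‴ ∩ {p ∣ ∏ c_ℓ} by the Kolyvagin road at `p ≥ 5`
# (cell `bsd-stepL`, seat `bsd-stepL-imc-p1` g5; `--supports stmt-BirchSwinnertonDyer-19624`; Theses-FREE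
# imports — a route file may import this module for its `closes`)

HONEST FRAMING. THEOREMS ONLY (no definition, no named fact, no `sorry`); nothing about Kolyvagin's conjecture or
about BSD is asserted; every published ∕ cited named fact is a HYPOTHESIS; `hZα` ∕ `hZ₅` (Kolyvagin non-vanishing
mod `p` in the ∀-frame ♯ typing at Hoffstein–Luo fields, `p ≥ 5`) are HYPOTHESES in the exact shape of the KOLY
route's deciding crux `Theses.KolyvaginRoadThree.ZhangSharpFrameAtThreeHL` with `3 ↦ p ≥ 5` (Skinner–Zhang
arXiv:1407.1099 Thm. 1.3 on its ♠-locus, PREPRINT; the cell's refereed memo THEOREM SZ14♯ = MEMO-v5 on the Locus;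
conjecture-tagged tree statement `Koly.SkinnerZhangSharp`). BSD is proved for no pair here; no census number of
record moves. Companion of `ErratumRoadFiveKolyvaginKernelHLFive.lean` (the pair-level HL kernel at `p ≥ 5`).

## What this file proves

* §3 `Koly.ramNoErratumData_of_kolyvaginFramesHLAlpha_of_restTam` — REST‴ (the body of
  `Theses.ErratumRoadFive.RamNoErratumDataAtFive`, VERBATIM) ⟸ published facts + McCallum + Darmon Thm. 3.6 +
  JSW17 Thm. 3.3.1-mult + `hZα` (the ∀-frame ♯ hypothesis at `p ≥ 5` restricted to the (α) ∩ Locus pairs: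
  `ClassX11b`, `Ram`, `p ∤ ∏ c_ℓ`, NO odd non-split `E[p]`-ramified multiplicative witness) + REST⁗ (REST‴ with the
  extra binder `p ∣ W.tamagawaProduct`). Atom (β) of REST‴ (`E(ℚ_p)[p] ≠ 0`) lies inside `{p ∣ c_p}`
  (`Koly.dvd_tamagawaProduct_of_not_localTorsionFree`), so on `p ∤ ∏ c_ℓ` only (α) pairs occur.
  `Koly.restTam_of_ramNoErratumData`: the converse bookkeeping (nothing is lost).
* §4 `Koly.openInputOnTree_onLocus_of_kolyvaginFramesHL_of_thm331Mult` ∕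
  `Koly.bsdp_onLocus_of_kolyvaginFramesHL_of_darmon36` — class level on the WHOLE Locus at `p ≥ 5` (the erratum
  locus included; the Kolyvagin road does not read the splitting type of the (ram) witness): `hZ₅` ⟹
  `P2OpenInputOnTreeAt W p` (resp. `BSDp W p`) at every X11b pair with `p ≥ 5`, a (ram) witness, `p ∤ ∏ c_ℓ`.

CENSUS WORDS (class-wide cw pairs, `p ≥ 5`, `N < 5·10⁵`, multr1-p1 `census2_all_500k`, imc-p1 g3 fold): REST‴ ∩ (ram)
= 703 204 = (α) 700 633 + (β) 2 571; Locus = 2 093 111 of the 2 155 109 (ram) pairs, so REST⁗ ⊆ (ram) ∖ Locus has at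
most 61 998 cw pairs (exact fold in the seat's evidence note on item 19624). CONDITIONAL on every binder.

References (locators only): [cite: SkinnerZhang2014, Thm. 1.3 (§1 p. 3), §12.3 — shape of `hZα`, `hZ₅`]
[cite: McCallumLMS1991, §5 Cor. 5.6 (p. 310)] [cite: Darmon2004, Thm. 3.6 (PDF pp. 43–44)]
[cite: JetchevSkinnerWan2017, Thm. 3.3.1, §7.4.1] [cite: Castella2018Erratum, Thm. 1.1 (iii)–(iv), (2.4)]
[cite: SilvermanATAEC1994, Cor. IV.9.2(d)].
-/

noncomputable section

open scoped Classical

namespace Summit.BirchSwinnertonDyer.Rank1Residual.X11b.Three.Koly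

open WeierstrassCurve Literature.NumberTheory.EllipticCurves
  Literature.NumberTheory.EllipticCurves.ModularForms
  Literature.NumberTheory.EllipticCurves.Rank1Residual
  Summit.BirchSwinnertonDyer.Rank1Residual Summit.BirchSwinnertonDyer.Rank1Residual.X11b

/-! ### §3 REST‴ shrinks to its Tamagawa part REST⁗ -/

/-- **REST‴ ⟸ the Kolyvagin road on (α) ∩ Locus + REST⁗.** The body of the crux
`Theses.ErratumRoadFive.RamNoErratumDataAtFive` (item 19624), VERBATIM — `P2OpenInputOnTreeAt W p` at every (ram)
pair with no erratum datum (no odd non-split `E[p]`-ramified multiplicative `q ≠ p`, or `E(ℚ_p)[p] ≠ 0`) — follows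
from: the published named facts; McCallum's structure theorem `hMc`; Darmon Thm. 3.6 at conductor 1 (`h36`, seam
G-a); the JSW17 Thm. 3.3.1-mult control fact (`h331`); `hZα` = Kolyvagin's conjecture mod `p` in the ∀-frame ♯
typing at `p ≥ 5` asked ONLY on the (α) ∩ Locus pairs — `(E,p) ∈ X11b`, `p ∥ N`, `ρ̄_{E,p}` onto, a (ram) witness,
`p ∤ ∏ c_ℓ`, and EVERY odd multiplicative `q ≠ p` with `E` non-split at `q` has `p ∣ v_q(Δ_min)` — at every
Hoffstein–Luo field (`d_K` odd, Heegner, `L(E^{d_K},1) ≠ 0`, `d_K ≠ −3`) and every Manin-good conductor-1 frame;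
and REST⁗ (`hrest`) = the same open input on the REST‴ pairs WITH `p ∣ ∏ c_ℓ`. Case split on `p ∣ ∏ c_ℓ`: on
`p ∤ ∏ c_ℓ` condition (iv) holds (`localTorsion_eq_zero_of_not_dvd_tamagawaProduct`), so the pair is an (α) pair and
§2 applies with the control identity from `h331` (`p2ControlOnTreeAt_of_thm331Mult`). CONDITIONAL on every
binder; nothing booked; (β) ⊆ `{p ∣ c_p}` so REST⁗ ⊇ (β). [cite: SkinnerZhang2014, Thm. 1.3 (shape of `hZα`)]
[cite: McCallumLMS1991, §5 Cor. 5.6 (p. 310)] [cite: JetchevSkinnerWan2017, Thm. 3.3.1 and §7.4.1]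
[cite: Castella2018Erratum, Thm. 1.1 (iii)–(iv)] [cite: SilvermanATAEC1994, Cor. IV.9.2(d)] -/
theorem ramNoErratumData_of_kolyvaginFramesHLAlpha_of_restTam
    (hGZ : ∀ (N : ℕ) [NeZero N] (W : WeierstrassCurve ℚ) (K : Type) [Field K] [NumberField K],
      gross_zagier N W K)
    (hKo : ∀ (N : ℕ) [NeZero N] (W : WeierstrassCurve ℚ) (K : Type) [Field K] [NumberField K],
      kolyvagin N W K)
    (hB : ∀ (N : ℕ) [NeZero N] (W : WeierstrassCurve ℚ) (K : Type) [Field K] [NumberField K],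
      Kolyvagin1990_padicValNat_card_sha_le N W K)
    (hSk : Skinner2016.thmC_padicValRat_bsd_rank_zero)
    (hGZK : rank_eq_analyticRank_of_analyticRank_le_one) (hmod : hasEntireLFunction_rat)
    (hnf : exists_isNewformOf) (hHL : HoffsteinLuo1997_exists_twist_L_one_ne_zero)
    (hMaz : mazur_not_dvd_maninConstant_of_odd)
    (hrec : ∀ (N : ℕ) [NeZero N] (W : WeierstrassCurve ℚ) (K : Type) [Field K] [NumberField K],
      heegnerPointOfConductor_one_galoisConj N W K)
    (hMc : McCallum1991_pow_dvd_card_sha_primary_of_certificate)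
    (h36 : ∀ (N : ℕ) [NeZero N] (W : WeierstrassCurve ℚ) (K : Type) [Field K] [NumberField K],
      phi_heegnerTau_mem_range_map_singularModuliField N W K)
    (h331 : JetchevSkinnerWan2017.thm331_anticyclotomicControl_mult)
    -- Kolyvagin's conjecture mod p, ∀-frame ♯ typing at p ≥ 5, on the (α) ∩ Locus pairs at Hoffstein–Luo fields
    (hZα : ∀ (W : WeierstrassCurve ℚ) [W.IsElliptic] [W.IsGloballyMinimal] [NeZero (W.conductorNorm ℤ)]
      (p : ℕ) [hp : Fact p.Prime] (K : Type) [Field K] [NumberField K]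
      (Dt : ModularParametrizationData W (W.conductorNorm ℤ)) (β : ℤ) (ι : K →+* ℂ),
      ClassX11b W p → 5 ≤ p → W.HasMultiplicativeReductionAtPrime p → Rank1Residual.Surj W p →
      Rank1Residual.Ram W p → ¬ p ∣ W.tamagawaProduct →
      (∀ (q : ℕ) [Fact q.Prime], q ≠ 2 → q ≠ p → Rank1Residual.Mult W q →
        ¬ W.HasSplitMultiplicativeReductionAtPrime q → p ∣ padicValInt q W.minimalDiscriminantInt) →
      IsImaginaryQuadratic K → Odd (NumberField.discr K) →
      SatisfiesHeegnerHypothesis (W.conductorNorm ℤ) K →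
      (W.quadraticTwist (NumberField.discr K : ℚ)).entireLFunction 1 ≠ 0 →
      NumberField.discr K ≠ -3 →
      (4 * (W.conductorNorm ℤ : ℤ)) ∣ β ^ 2 - NumberField.discr K → ¬ (p : ℤ) ∣ Dt.c →
      ∃ (n : ℕ) (d : KolyvaginHeegnerData Dt β ι n),
        KolyvaginDescent.KolSupp (Zhang2014.IsKolyvaginPrime (W.conductorNorm ℤ) W K p) n ∧
          d.kolyvaginClass hp.out 1 ≠ 0)
    -- REST⁗: the open input on the REST‴ pairs with p ∣ ∏ c_ℓ
    (hrest : ∀ (W : WeierstrassCurve ℚ) [W.IsElliptic] [W.IsGloballyMinimal] (p : ℕ) [Fact p.Prime],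
      Rank1Residual.Ram W p →
      ¬ ((∃ (q : ℕ) (_ : Fact q.Prime), q ≠ 2 ∧ q ≠ p ∧ Rank1Residual.Mult W q ∧
            ¬ W.HasSplitMultiplicativeReductionAtPrime q ∧ ¬ p ∣ padicValInt q W.minimalDiscriminantInt) ∧
          (∀ P : (W.baseChange ℚ_[p]).toAffine.Point, p • P = 0 → P = 0)) →
      p ∣ W.tamagawaProduct → P2OpenInputOnTreeAt W p) :
    ∀ (W : WeierstrassCurve ℚ) [W.IsElliptic] [W.IsGloballyMinimal] (p : ℕ) [Fact p.Prime],
      Rank1Residual.Ram W p →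
      ¬ ((∃ (q : ℕ) (_ : Fact q.Prime), q ≠ 2 ∧ q ≠ p ∧ Rank1Residual.Mult W q ∧
            ¬ W.HasSplitMultiplicativeReductionAtPrime q ∧ ¬ p ∣ padicValInt q W.minimalDiscriminantInt) ∧
          (∀ P : (W.baseChange ℚ_[p]).toAffine.Point, p • P = 0 → P = 0)) →
      P2OpenInputOnTreeAt W p := by
  intro W _ _ p hp hram hno
  by_cases htam : p ∣ W.tamagawaProduct
  · exact hrest W p hram hno htam
  -- off the Tamagawa atom: the pair is an (α) pair and the Kolyvagin road applies
  intro N _ K _ _ Dt H ι P hX hp5 hs hN hK hodd hpd hμ hHN hLt hP hc hPinf κ hκ γ _ 𝔭 h𝔭 he hf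
  haveI : NeZero (W.conductorNorm ℤ) := ⟨(W.conductorNorm_pos_holds).ne'⟩
  have hmult : W.HasMultiplicativeReductionAtPrime p := hX.2.2.1
  -- (iv) is automatic on p ∤ ∏ c_ℓ
  have hiv : ∀ Q : (W.baseChange ℚ_[p]).toAffine.Point, p • Q = 0 → Q = 0 :=
    LocalTorsion.localTorsion_eq_zero_of_not_dvd_tamagawaProduct W p (le_trans (by norm_num) hp5) hmult htam
  -- hence no odd non-split E[p]-ramified witness
  have hα : ∀ (q : ℕ) [Fact q.Prime], q ≠ 2 → q ≠ p → Rank1Residual.Mult W q →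
      ¬ W.HasSplitMultiplicativeReductionAtPrime q → p ∣ padicValInt q W.minimalDiscriminantInt := by
    intro q _ hq2 hqp hmq hnsq
    by_contra hv
    exact hno ⟨⟨q, inferInstance, hq2, hqp, hmq, hnsq, hv⟩, hiv⟩
  have hC : P2ControlOnTreeAt W p :=
    Summit.BirchSwinnertonDyer.BirchSwinnertonDyer.Theorems.p2ControlOnTreeAt_of_thm331Mult W p h331 hKo
  exact openInputOnTreeAt_of_kolyvaginFramesHLAt_of_five_le hGZ hKo hB hSk hGZK hmod hnf hHL hMaz hrec hMc
    (Summit.BirchSwinnertonDyer.BirchSwinnertonDyer.Theorems.kolyvaginRoadThree_hKD_of_darmon36 h36) W p hX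
    hp5 hram htam hC
    (fun K _ _ Dt β ι hK' hodd' hHN' hLt' h3' hβ hc' ↦
      hZα W p K Dt β ι hX hp5 hmult hs hram htam hα hK' hodd' hHN' hLt' h3' hβ hc')
    N K Dt H ι P hX hp5 hs hN hK hodd hpd hμ hHN hLt hP hc hPinf κ hκ γ 𝔭 h𝔭 he hf

/-- **Converse bookkeeping: REST‴ ⟹ REST⁗** (drop the binder `p ∣ ∏ c_ℓ`; nothing is lost in §3's reduction).
[folklore] -/
theorem restTam_of_ramNoErratumData
    (h : ∀ (W : WeierstrassCurve ℚ) [W.IsElliptic] [W.IsGloballyMinimal] (p : ℕ) [Fact p.Prime],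
      Rank1Residual.Ram W p →
      ¬ ((∃ (q : ℕ) (_ : Fact q.Prime), q ≠ 2 ∧ q ≠ p ∧ Rank1Residual.Mult W q ∧
            ¬ W.HasSplitMultiplicativeReductionAtPrime q ∧ ¬ p ∣ padicValInt q W.minimalDiscriminantInt) ∧
          (∀ P : (W.baseChange ℚ_[p]).toAffine.Point, p • P = 0 → P = 0)) →
      P2OpenInputOnTreeAt W p) :
    ∀ (W : WeierstrassCurve ℚ) [W.IsElliptic] [W.IsGloballyMinimal] (p : ℕ) [Fact p.Prime],
      Rank1Residual.Ram W p →
      ¬ ((∃ (q : ℕ) (_ : Fact q.Prime), q ≠ 2 ∧ q ≠ p ∧ Rank1Residual.Mult W q ∧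
            ¬ W.HasSplitMultiplicativeReductionAtPrime q ∧ ¬ p ∣ padicValInt q W.minimalDiscriminantInt) ∧
          (∀ P : (W.baseChange ℚ_[p]).toAffine.Point, p • P = 0 → P = 0)) →
      p ∣ W.tamagawaProduct → P2OpenInputOnTreeAt W p :=
  fun W _ _ p _ hram hno _ ↦ h W p hram hno

/-- **On the REST⁗ pairs off the (β) atom nothing changes: (β) lies inside `{p ∣ c_p}`.** At a multiplicative
`p ≥ 3`, a non-zero `P ∈ E(ℚ_p)` with `p • P = 0` forces `p ∣ ∏ c_ℓ` — so the REST‴ pairs failing (iv) are REST⁗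
pairs, and on `p ∤ ∏ c_ℓ` REST‴ consists of (α) pairs only (used in §3). Restated here for the planner's split.
[cite: SilvermanATAEC1994, Cor. IV.9.2(d) with (b) (PDF p. 340)] -/
theorem dvd_tamagawaProduct_of_not_localTorsionFree (W : WeierstrassCurve ℚ) [W.IsElliptic]
    [W.IsGloballyMinimal] (p : ℕ) [Fact p.Prime] (hp3 : 3 ≤ p) (hmult : Rank1Residual.Mult W p)
    (h : ¬ ∀ P : (W.baseChange ℚ_[p]).toAffine.Point, p • P = 0 → P = 0) :
    p ∣ W.tamagawaProduct := by
  by_contra htam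
  exact h (LocalTorsion.localTorsion_eq_zero_of_not_dvd_tamagawaProduct W p hp3 hmult htam)

/-! ### §4 Class level on the whole Locus at `p ≥ 5` -/

/-- **The Kolyvagin road on the WHOLE Locus at `p ≥ 5`, class level, ∀-frame ♯ typing** (the erratum locus
included — the road does not read the splitting type of the (ram) witness): published facts + McCallum + Darmon 3.6
+ JSW 3.3.1-mult + `hZ₅` (Kolyvagin's conjecture mod `p` at every Manin-good conductor-1 frame of every
Hoffstein–Luo field of every Locus pair, `p ≥ 5`) ⟹ route p2's open input `P2OpenInputOnTreeAt W p` at every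
X11b pair with `p ≥ 5`, a (ram) witness and `p ∤ ∏ c_ℓ` (class-wide 2 093 111 of the 2 155 109 (ram) pairs,
`N < 5·10⁵`). CONDITIONAL on every binder; nothing booked. [cite: SkinnerZhang2014, Thm. 1.3 (shape of `hZ₅`)]
[cite: McCallumLMS1991, §5 Cor. 5.6 (p. 310)] [cite: Darmon2004, Thm. 3.6] [cite: JetchevSkinnerWan2017, Thm. 3.3.1] -/
theorem openInputOnTree_onLocus_of_kolyvaginFramesHL_of_thm331Mult
    (hGZ : ∀ (N : ℕ) [NeZero N] (W : WeierstrassCurve ℚ) (K : Type) [Field K] [NumberField K],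
      gross_zagier N W K)
    (hKo : ∀ (N : ℕ) [NeZero N] (W : WeierstrassCurve ℚ) (K : Type) [Field K] [NumberField K],
      kolyvagin N W K)
    (hB : ∀ (N : ℕ) [NeZero N] (W : WeierstrassCurve ℚ) (K : Type) [Field K] [NumberField K],
      Kolyvagin1990_padicValNat_card_sha_le N W K)
    (hSk : Skinner2016.thmC_padicValRat_bsd_rank_zero)
    (hGZK : rank_eq_analyticRank_of_analyticRank_le_one) (hmod : hasEntireLFunction_rat)
    (hnf : exists_isNewformOf) (hHL : HoffsteinLuo1997_exists_twist_L_one_ne_zero)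
    (hMaz : mazur_not_dvd_maninConstant_of_odd)
    (hrec : ∀ (N : ℕ) [NeZero N] (W : WeierstrassCurve ℚ) (K : Type) [Field K] [NumberField K],
      heegnerPointOfConductor_one_galoisConj N W K)
    (hMc : McCallum1991_pow_dvd_card_sha_primary_of_certificate)
    (h36 : ∀ (N : ℕ) [NeZero N] (W : WeierstrassCurve ℚ) (K : Type) [Field K] [NumberField K],
      phi_heegnerTau_mem_range_map_singularModuliField N W K)
    (h331 : JetchevSkinnerWan2017.thm331_anticyclotomicControl_mult)
    (hZ₅ : ∀ (W : WeierstrassCurve ℚ) [W.IsElliptic] [W.IsGloballyMinimal] [NeZero (W.conductorNorm ℤ)]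
      (p : ℕ) [hp : Fact p.Prime] (K : Type) [Field K] [NumberField K]
      (Dt : ModularParametrizationData W (W.conductorNorm ℤ)) (β : ℤ) (ι : K →+* ℂ),
      ClassX11b W p → 5 ≤ p → W.HasMultiplicativeReductionAtPrime p → Rank1Residual.Surj W p →
      Rank1Residual.Ram W p → ¬ p ∣ W.tamagawaProduct →
      IsImaginaryQuadratic K → Odd (NumberField.discr K) →
      SatisfiesHeegnerHypothesis (W.conductorNorm ℤ) K →
      (W.quadraticTwist (NumberField.discr K : ℚ)).entireLFunction 1 ≠ 0 →
      NumberField.discr K ≠ -3 →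
      (4 * (W.conductorNorm ℤ : ℤ)) ∣ β ^ 2 - NumberField.discr K → ¬ (p : ℤ) ∣ Dt.c →
      ∃ (n : ℕ) (d : KolyvaginHeegnerData Dt β ι n),
        KolyvaginDescent.KolSupp (Zhang2014.IsKolyvaginPrime (W.conductorNorm ℤ) W K p) n ∧
          d.kolyvaginClass hp.out 1 ≠ 0) :
    ∀ (W : WeierstrassCurve ℚ) [W.IsElliptic] [W.IsGloballyMinimal] (p : ℕ) [Fact p.Prime],
      ClassX11b W p → 5 ≤ p → Rank1Residual.Ram W p → ¬ p ∣ W.tamagawaProduct →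
      P2OpenInputOnTreeAt W p := by
  intro W _ _ p hp hX hp5 hram htam
  haveI : NeZero (W.conductorNorm ℤ) := ⟨(W.conductorNorm_pos_holds).ne'⟩
  have hmult : W.HasMultiplicativeReductionAtPrime p := hX.2.2.1
  have hs : Rank1Residual.Surj W p := surj_of_irr_of_ram W p hX.2.2.2 hram
  exact openInputOnTreeAt_of_kolyvaginFramesHLAt_of_five_le hGZ hKo hB hSk hGZK hmod hnf hHL hMaz hrec hMc
    (Summit.BirchSwinnertonDyer.BirchSwinnertonDyer.Theorems.kolyvaginRoadThree_hKD_of_darmon36 h36) W p hX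
    hp5 hram htam
    (Summit.BirchSwinnertonDyer.BirchSwinnertonDyer.Theorems.p2ControlOnTreeAt_of_thm331Mult W p h331 hKo)
    (fun K _ _ Dt β ι hK hodd hHN hLt h3 hβ hc ↦
      hZ₅ W p K Dt β ι hX hp5 hmult hs hram htam hK hodd hHN hLt h3 hβ hc)

/-- **… and `BSD(E,p)` itself on the whole Locus at `p ≥ 5`** from the same inputs without the control fact
(the Kolyvagin road closes the class record's conclusion directly; the open input of route p2 is only needed to
feed the K2 route's `closes`). CONDITIONAL on every binder; nothing booked. [cite: SkinnerZhang2014, Thm. 1.2–1.3 (shape)]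
[cite: McCallumLMS1991, §5 Cor. 5.6 (p. 310)] [cite: Darmon2004, Thm. 3.6] -/
theorem bsdp_onLocus_of_kolyvaginFramesHL_of_darmon36
    (hGZ : ∀ (N : ℕ) [NeZero N] (W : WeierstrassCurve ℚ) (K : Type) [Field K] [NumberField K],
      gross_zagier N W K)
    (hKo : ∀ (N : ℕ) [NeZero N] (W : WeierstrassCurve ℚ) (K : Type) [Field K] [NumberField K],
      kolyvagin N W K)
    (hB : ∀ (N : ℕ) [NeZero N] (W : WeierstrassCurve ℚ) (K : Type) [Field K] [NumberField K],
      Kolyvagin1990_padicValNat_card_sha_le N W K)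
    (hSk : Skinner2016.thmC_padicValRat_bsd_rank_zero)
    (hGZK : rank_eq_analyticRank_of_analyticRank_le_one) (hmod : hasEntireLFunction_rat)
    (hnf : exists_isNewformOf) (hHL : HoffsteinLuo1997_exists_twist_L_one_ne_zero)
    (hMaz : mazur_not_dvd_maninConstant_of_odd)
    (hrec : ∀ (N : ℕ) [NeZero N] (W : WeierstrassCurve ℚ) (K : Type) [Field K] [NumberField K],
      heegnerPointOfConductor_one_galoisConj N W K)
    (hMc : McCallum1991_pow_dvd_card_sha_primary_of_certificate)
    (h36 : ∀ (N : ℕ) [NeZero N] (W : WeierstrassCurve ℚ) (K : Type) [Field K] [NumberField K],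
      phi_heegnerTau_mem_range_map_singularModuliField N W K)
    (hZ₅ : ∀ (W : WeierstrassCurve ℚ) [W.IsElliptic] [W.IsGloballyMinimal] [NeZero (W.conductorNorm ℤ)]
      (p : ℕ) [hp : Fact p.Prime] (K : Type) [Field K] [NumberField K]
      (Dt : ModularParametrizationData W (W.conductorNorm ℤ)) (β : ℤ) (ι : K →+* ℂ),
      ClassX11b W p → 5 ≤ p → W.HasMultiplicativeReductionAtPrime p → Rank1Residual.Surj W p →
      Rank1Residual.Ram W p → ¬ p ∣ W.tamagawaProduct →
      IsImaginaryQuadratic K → Odd (NumberField.discr K) →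
      SatisfiesHeegnerHypothesis (W.conductorNorm ℤ) K →
      (W.quadraticTwist (NumberField.discr K : ℚ)).entireLFunction 1 ≠ 0 →
      NumberField.discr K ≠ -3 →
      (4 * (W.conductorNorm ℤ : ℤ)) ∣ β ^ 2 - NumberField.discr K → ¬ (p : ℤ) ∣ Dt.c →
      ∃ (n : ℕ) (d : KolyvaginHeegnerData Dt β ι n),
        KolyvaginDescent.KolSupp (Zhang2014.IsKolyvaginPrime (W.conductorNorm ℤ) W K p) n ∧
          d.kolyvaginClass hp.out 1 ≠ 0)
    (W : WeierstrassCurve ℚ) [W.IsElliptic] [W.IsGloballyMinimal] (p : ℕ) [hp : Fact p.Prime]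
    (hX : ClassX11b W p) (hp5 : 5 ≤ p) (hram : Rank1Residual.Ram W p) (htam : ¬ p ∣ W.tamagawaProduct) :
    BSDp W p := by
  haveI : NeZero (W.conductorNorm ℤ) := ⟨(W.conductorNorm_pos_holds).ne'⟩
  have hmult : W.HasMultiplicativeReductionAtPrime p := hX.2.2.1
  have hs : Rank1Residual.Surj W p := surj_of_irr_of_ram W p hX.2.2.2 hram
  exact bsdp_of_kolyvaginFramesHLAt_of_five_le hGZ hKo hB hSk hGZK hmod hnf hHL hMaz hrec hMc
    (Summit.BirchSwinnertonDyer.BirchSwinnertonDyer.Theorems.kolyvaginRoadThree_hKD_of_darmon36 h36) W p hX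
    hp5 hram htam
    (fun K _ _ Dt β ι hK hodd hHN hLt h3 hβ hc ↦
      hZ₅ W p K Dt β ι hX hp5 hmult hs hram htam hK hodd hHN hLt h3 hβ hc)

end Summit.BirchSwinnertonDyer.Rank1Residual.X11b.Three.Koly

end
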